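import Literature.RepresentationTheory.MoeglinVignerasWaldspurger1987.RankOneThetaLiftTwistReduction
import Literature.RepresentationTheory.MoeglinVignerasWaldspurger1987.RankOneThetaLiftRationalHyperbolicFrame
import Literature.NumberTheory.GelbartRogawski1991.LocalUnitaryBlockRestriction
import Literature.RepresentationTheory.SeesawScalarCharacter
import HarnessLib

/-!
# Row IV-4c3 `rankOne_theta_twist_rigidity` from rank `1 × 1` non-periodicity: the route-R wrapper

Topic `RepresentationTheory/MoeglinVignerasWaldspurger1987`; namespace
`Literature.RepresentationTheory.MoeglinVignerasWaldspurger1987`.  THEOREMS ONLY (no definition, no named fact, no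
`sorry`).  Cell `hodgecm-mathlib`, fan B, route R for the named fact IV-4c3 `rankOne_theta_twist_rigidity`
(`RankOneThetaLiftTwistRigidity.lean`: two splittings of `U(J)(F_v)` over `ι_v` with isomorphic non-zero rank-one theta
lifts are equal), B-p03's `R1-SPEC` §Remaining, assembled BY NAME:

**`rankOne_theta_twist_rigidity_of_nonPeriodic₁₁ (hNP) (hframe) (hblock) : rankOne_theta_twist_rigidity`**, where the
three hypotheses are EXPLICIT `∀`-statements (no new `def`):

* `hNP` — **rank `1 × 1` non-periodicity** (`NonPeriodic₁₁` of the spec): for a `1 × 1` Gram matrix `t`, a non-split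
  place `v`, a section `s : U(J_t)(F_v) →* S̃p(𝕎_v)` over `ι_v` with `ω_s` smooth and a character `η` of `U(J_t)(F_v)` with
  open kernel, if the set of unitary continuous `ξ` with `Coinv_ξ(ω_s) ≠ 0` is invariant under `ξ ↦ ξ · η` then `η = 1`
  (the `(U(1), U(1))` oscillator representation admits no period; [HarrisKudlaSweet1996, Thm. 6.1] ε-dichotomy — NOT
  proved in the tree, carried as a hypothesis);
* `hframe` — **invariance of one-section twist rigidity under a RATIONAL change of frame** `T ↦ Pᵀ T P`, `P ∈ GL₃(F)`
  (route-R piece R1d-ii `twistRigid_of_congr`, transport of structure along `g ↦ P g P⁻¹`,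
  [MoeglinVignerasWaldspurger1987, Chap. 2 II Remarque (3)]; to be discharged by the `FrameTransport` file);
* `hblock` — **twist rigidity in block form modulo non-periodicity of the line block** (route-R piece R1-asm; this is
  VERBATIM the statement of B-p03's `twistRigid_block_of_nonPeriodic`, `RankOneThetaLiftTwistRigidBlock.lean`, and is
  discharged by that theorem the moment it lands).

Composition (§2): by B-p05's reduction `rankOne_theta_twist_rigidity_of_twistRigid` it suffices to prove one-section
twist rigidity at every `(T, J = T ⊗ 1, v)` with `v` non-split; B-p11's `RationalHyperbolicFrame.exists_rational_hyperbolic_frame`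
gives a rational `P` with `Pᵀ T P = t ⊕ᶠ T_H` and the hermitian plane `(E_v², T_H ⊗ 1)` ISOTROPIC; `hframe` moves the
problem to the block frame `t ⊕ᶠ T_H`; there `hblock` applies, its non-periodicity hypothesis for the line block
`ω_{restrictLeft s}` being the instance of `hNP` at the restricted section (`BlockSum.restrictLeft`, over `ι_v` by
`BlockSum.proj_restrictLeft`, smooth by `BlockSum.isSmooth_restrictLeft`).  The currency match `(1 + 2 : ℕ) = 3` is `rfl`.

§1 records the instance of `hNP` used (`nonPeriodic_restrictLeft`).  HC_CM is NOT proved here: this file isolates the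
residual content of IV-4c3 as the rank `1 × 1` statement `hNP` plus the frame transport `hframe`; HC_CM is proved only
modulo the 7 printed citations until rung 0 of the ladder closes.

## References
* [MoeglinVignerasWaldspurger1987] C. Mœglin, M.-F. Vignéras, J.-L. Waldspurger, LNM 1291 (1987), Chap. 2 II.1 Rem. (6),
  II Remarque (3); Chap. 3 IV.4.
* [GelbartRogawski1991] S. Gelbart, J. Rogawski, Invent. Math. 105 (1991), §3 pp. 455–462.
* [HarrisKudlaSweet1996] M. Harris, S. Kudla, W. Sweet, J. AMS 9 (1996), Thm. 6.1.
* [Liu2021] Y. Liu, Camb. J. Math. 9 (2021), App. D Lem. D.1 (3).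
-/

set_option autoImplicit false

noncomputable section

open NumberField IsDedekindDomain Matrix
open scoped Matrix MatrixGroups
open Literature.RepresentationTheory (SeesawScalar.twist SeesawScalar.twist_apply)
open Literature.RepresentationTheory.HeisenbergGroup
open Literature.NumberTheory.GelbartRogawski1991.UnitaryDualPair.LocalSplitting
open Literature.NumberTheory.GelbartRogawski1991.UnitaryDualPair.LocalSplitting.BlockSum
open Literature.NumberTheory.Automorphic
open Literature.NumberTheory.Automorphic.UnitaryGroup
open Literature.NumberTheory.Automorphic.Liu2021

namespace Literature.RepresentationTheory.MoeglinVignerasWaldspurger1987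

/-! ## §1 The instance of rank `1 × 1` non-periodicity on the line block of `t ⊕ᶠ T_H` -/

section Block

variable (F : Type) [Field F] [NumberField F] (E : Type) [Field E] [NumberField E] [Algebra F E]
  [Algebra.IsQuadraticExtension F E] (c : E ≃ₐ[F] E) {δ : E} (hcδ : c δ = -δ) (hδ : δ ≠ 0) {d : F}
  (hd : δ * δ = algebraMap F E d) (v : HeightOneSpectrum (𝓞 F))
  {t : Matrix (Fin 1) (Fin 1) F} {T₂ : Matrix (Fin 2) (Fin 2) F} (ht : t.IsSymm) (hT₂ : T₂.IsSymm)
  (htd : IsUnit t.det) (hT₂d : IsUnit T₂.det)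
  {J₁ : Matrix (Fin 1) (Fin 1) E} (hJ₁ : J₁ = t.map (algebraMap F E))
  {J : Matrix (Fin (1 + 2)) (Fin (1 + 2)) E} (hJ : J = (UnitaryGroup.finSum 1 2 t T₂).map (algebraMap F E))
  (s : localPi E c (1 + 2) J v →* LocalMp F (1 + 2) (UnitaryGroup.finSum 1 2 t T₂) v)
  (hs : ∀ g, MpPsi.proj _ (s g) =
    iota F E c (1 + 2) hcδ hδ hd (UnitaryGroup.finSum 1 2 t T₂) (UnitaryGroup.isSymm_finSum ht hT₂) hJ v g)

include htd in
/-- **rank `1 × 1` non-periodicity, instantiated on the line block**: if `hNP` holds for every `1 × 1` datum, it holds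
for the restricted section `restrictLeft s : U(J_t)(F_v) →* S̃p(𝕎_{t,v})` of a section `s` of `U(t ⊕ᶠ T_H)(F_v)` over
`ι_v` with `ω_s` smooth (`restrictLeft s` lies over `ι_v`, `BlockSum.proj_restrictLeft`, and `ω_{restrictLeft s}` is
smooth, `BlockSum.isSmooth_restrictLeft`). [cite: MoeglinVignerasWaldspurger1987, Chap. 2 II.1 Rem. (6) and II.8] -/
theorem nonPeriodic_restrictLeft
    (hNP : ∀ (F : Type) [Field F] [NumberField F] (E : Type) [Field E] [NumberField E] [Algebra F E]
      [Algebra.IsQuadraticExtension F E] (c : E ≃ₐ[F] E) (δ : E) (hcδ : c δ = -δ) (hδ : δ ≠ 0) (d : F)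
      (hd : δ * δ = algebraMap F E d) (t : Matrix (Fin 1) (Fin 1) F) (ht : t.IsSymm) (_htd : IsUnit t.det)
      (J₁ : Matrix (Fin 1) (Fin 1) E) (hJ₁ : J₁ = t.map (algebraMap F E)) (v : HeightOneSpectrum (𝓞 F))
      (_hE : IsField (UnitaryGroup.LocalRing E v))
      (s₁ : localPi E c 1 J₁ v →* LocalMp F 1 t v)
      (_hs₁ : ∀ g, MpPsi.proj _ (s₁ g) = iota F E c 1 hcδ hδ hd t ht hJ₁ v g)
      (_hsm₁ : Representation.IsSmooth ((MpPsi.toRep (localSchrodinger F 1 t v)).comp s₁))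
      (η₁ : localPi E c 1 J₁ v →* ℂˣ)
      (_hη₁ : IsOpen ((η₁.ker : Subgroup (localPi E c 1 J₁ v)) : Set (localPi E c 1 J₁ v))),
      (∀ (ξ : localPi E c 1 J₁ v →* ℂˣ), (∀ u, ‖((ξ u : ℂˣ) : ℂ)‖ = 1) → (Continuous fun u => ((ξ u : ℂˣ) : ℂ)) →
        (Nontrivial (TwistedCoinv.Coinv ((MpPsi.toRep (localSchrodinger F 1 t v)).comp s₁) ξ) ↔
          Nontrivial (TwistedCoinv.Coinv ((MpPsi.toRep (localSchrodinger F 1 t v)).comp s₁) (ξ * η₁)))) →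
      η₁ = 1)
    (hE : IsField (UnitaryGroup.LocalRing E v))
    (hsm : Representation.IsSmooth ((MpPsi.toRep (localSchrodinger F (1 + 2) (UnitaryGroup.finSum 1 2 t T₂) v)).comp s))
    (η₁ : localPi E c 1 J₁ v →* ℂˣ)
    (hη₁ : IsOpen ((η₁.ker : Subgroup (localPi E c 1 J₁ v)) : Set (localPi E c 1 J₁ v)))
    (hper : ∀ (ξ : localPi E c 1 J₁ v →* ℂˣ), (∀ u, ‖((ξ u : ℂˣ) : ℂ)‖ = 1) →
      (Continuous fun u => ((ξ u : ℂˣ) : ℂ)) →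
        (Nontrivial (TwistedCoinv.Coinv ((MpPsi.toRep (localSchrodinger F 1 t v)).comp
            (restrictLeft F E c v 1 2 hJ₁ hJ hcδ hδ hd ht hT₂ hT₂d s hs)) ξ) ↔
          Nontrivial (TwistedCoinv.Coinv ((MpPsi.toRep (localSchrodinger F 1 t v)).comp
            (restrictLeft F E c v 1 2 hJ₁ hJ hcδ hδ hd ht hT₂ hT₂d s hs)) (ξ * η₁)))) :
    η₁ = 1 :=
  hNP F E c δ hcδ hδ d hd t ht htd J₁ hJ₁ v hE (restrictLeft F E c v 1 2 hJ₁ hJ hcδ hδ hd ht hT₂ hT₂d s hs)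
    (proj_restrictLeft F E c v 1 2 hJ₁ hJ hcδ hδ hd ht hT₂ hT₂d s hs)
    (isSmooth_restrictLeft F E c v 1 2 hJ₁ hJ hcδ hδ hd ht hT₂ hT₂d s hs hsm) η₁ hη₁ hper

end Block

/-! ## §2 The wrapper: IV-4c3 from `hNP`, `hframe`, `hblock` -/

-- three thirty-binder hypotheses and a thirty-binder goal: about 4× the default elaboration budget
set_option maxHeartbeats 1600000 in
/-- **ROW IV-4c3 FROM RANK `1 × 1` NON-PERIODICITY (route R, assembled by name).**  The named fact
`rankOne_theta_twist_rigidity` — two splittings `s₁, s₂ : U(J)(F_v) →* S̃p(𝕎_v)` over `ι_v` (`J = T ⊗ 1` of rank `3`,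
`v` non-split, `ω_{sᵢ}` smooth) with `Θ_{s₁}(χ₁) ≅ Θ_{s₂}(χ₂) ≠ 0` are EQUAL — follows from:
`hNP` (rank `1 × 1` non-periodicity of the `(U(1), U(1))` oscillator representation, every `1 × 1` Gram matrix and
non-split place), `hframe` (one-section twist rigidity at `(T, v)` follows from the same at `(Pᵀ T P, v)` for a rational
`P ∈ GL₃(F)`) and `hblock` (one-section twist rigidity at a block frame `t ⊕ᶠ T_H` with `(E_v², T_H ⊗ 1)` isotropic,
modulo non-periodicity of the line block).  Proof: `rankOne_theta_twist_rigidity_of_twistRigid` (two sections differ by a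
character `η` with open kernel, so it suffices that `Θ_s(χ) ≅ η ⊗ Θ_s(χ′) ⇒ η = 1` for ONE section);
`RationalHyperbolicFrame.exists_rational_hyperbolic_frame` (a rational frame `Pᵀ T P = t ⊕ᶠ T_H` with isotropic plane
block at the non-split `v`); `hframe`; `hblock` fed with `nonPeriodic_restrictLeft`.
[cite: MoeglinVignerasWaldspurger1987, Chap. 3 IV.4 and Chap. 2 II.1 Rem. (6), II Remarque (3)]
[cite: GelbartRogawski1991, §3 pp. 461–462] [cite: Liu2021, App. D Lemma D.1 (3)] -/
theorem rankOne_theta_twist_rigidity_of_nonPeriodic₁₁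
    (hNP : ∀ (F : Type) [Field F] [NumberField F] (E : Type) [Field E] [NumberField E] [Algebra F E]
      [Algebra.IsQuadraticExtension F E] (c : E ≃ₐ[F] E) (δ : E) (hcδ : c δ = -δ) (hδ : δ ≠ 0) (d : F)
      (hd : δ * δ = algebraMap F E d) (t : Matrix (Fin 1) (Fin 1) F) (ht : t.IsSymm) (_htd : IsUnit t.det)
      (J₁ : Matrix (Fin 1) (Fin 1) E) (hJ₁ : J₁ = t.map (algebraMap F E)) (v : HeightOneSpectrum (𝓞 F))
      (_hE : IsField (UnitaryGroup.LocalRing E v))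
      (s₁ : localPi E c 1 J₁ v →* LocalMp F 1 t v)
      (_hs₁ : ∀ g, MpPsi.proj _ (s₁ g) = iota F E c 1 hcδ hδ hd t ht hJ₁ v g)
      (_hsm₁ : Representation.IsSmooth ((MpPsi.toRep (localSchrodinger F 1 t v)).comp s₁))
      (η₁ : localPi E c 1 J₁ v →* ℂˣ)
      (_hη₁ : IsOpen ((η₁.ker : Subgroup (localPi E c 1 J₁ v)) : Set (localPi E c 1 J₁ v))),
      (∀ (ξ : localPi E c 1 J₁ v →* ℂˣ), (∀ u, ‖((ξ u : ℂˣ) : ℂ)‖ = 1) → (Continuous fun u => ((ξ u : ℂˣ) : ℂ)) →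
        (Nontrivial (TwistedCoinv.Coinv ((MpPsi.toRep (localSchrodinger F 1 t v)).comp s₁) ξ) ↔
          Nontrivial (TwistedCoinv.Coinv ((MpPsi.toRep (localSchrodinger F 1 t v)).comp s₁) (ξ * η₁)))) →
      η₁ = 1)
    (hframe : ∀ (F : Type) [Field F] [NumberField F] (E : Type) [Field E] [NumberField E] [Algebra F E]
      [Algebra.IsQuadraticExtension F E] (c : E ≃ₐ[F] E) (δ : E) (hcδ : c δ = -δ) (hδ : δ ≠ 0) (d : F)
      (hd : δ * δ = algebraMap F E d) (T T' : Matrix (Fin 3) (Fin 3) F) (hT : T.IsSymm) (hT' : T'.IsSymm)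
      (_hTd : IsUnit T.det) (_hT'd : IsUnit T'.det)
      (J : Matrix (Fin 3) (Fin 3) E) (hJ : J = T.map (algebraMap F E))
      (J' : Matrix (Fin 3) (Fin 3) E) (hJ' : J' = T'.map (algebraMap F E))
      (P : GL (Fin 3) F) (_hP : (P : Matrix (Fin 3) (Fin 3) F)ᵀ * T * (P : Matrix (Fin 3) (Fin 3) F) = T')
      (v : HeightOneSpectrum (𝓞 F)) (_hE : IsField (UnitaryGroup.LocalRing E v)),
      -- one-section twist rigidity at `(T', J', v)` …
      (∀ (s : localPi E c 3 J' v →* LocalMp F 3 T' v)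
        (_hs : ∀ g, MpPsi.proj _ (s g) = iota F E c 3 hcδ hδ hd T' hT' hJ' v g)
        (_hsm : Representation.IsSmooth ((MpPsi.toRep (localSchrodinger F 3 T' v)).comp s))
        (η : localPi E c 3 J' v →* ℂˣ) (_hη : IsOpen ((η.ker : Subgroup (localPi E c 3 J' v)) : Set (localPi E c 3 J' v)))
        (J₁ : Matrix (Fin 1) (Fin 1) E) (hJ₁ : J₁ 0 0 ≠ 0) (χ χ' : localPi E c 1 J₁ v →* ℂˣ)
        (_hχu : ∀ z, ‖((χ z : ℂˣ) : ℂ)‖ = 1) (_hχc : Continuous fun z => ((χ z : ℂˣ) : ℂ))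
        (_hχ'u : ∀ z, ‖((χ' z : ℂˣ) : ℂ)‖ = 1) (_hχ'c : Continuous fun z => ((χ' z : ℂˣ) : ℂ))
        (_hnt : Nontrivial (TwistedCoinv.Coinv
          ((show Representation ℂ (localPi E c 1 J₁ v) (SchwartzBruhat (Fin 3 → v.adicCompletion F)) from
            ((MpPsi.toRep (localSchrodinger F 3 T' v)).comp s).comp (localCenter E c 3 J' J₁ hJ₁ v))) χ))
        (_hiso : AreIsomorphicRep
          (TwistedCoinv.rep
            (ρW := show Representation ℂ (localPi E c 1 J₁ v) (SchwartzBruhat (Fin 3 → v.adicCompletion F)) from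
              ((MpPsi.toRep (localSchrodinger F 3 T' v)).comp s).comp (localCenter E c 3 J' J₁ hJ₁ v))
            χ ((MpPsi.toRep (localSchrodinger F 3 T' v)).comp s)
            (fun g z => (show Commute g (localCenter E c 3 J' J₁ hJ₁ v z) from
              localCenter_comm E c 3 J' J₁ hJ₁ v z g).map ((MpPsi.toRep (localSchrodinger F 3 T' v)).comp s)))
          (SeesawScalar.twist η (TwistedCoinv.rep
            (ρW := show Representation ℂ (localPi E c 1 J₁ v) (SchwartzBruhat (Fin 3 → v.adicCompletion F)) from
              ((MpPsi.toRep (localSchrodinger F 3 T' v)).comp s).comp (localCenter E c 3 J' J₁ hJ₁ v))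
            χ' ((MpPsi.toRep (localSchrodinger F 3 T' v)).comp s)
            (fun g z => (show Commute g (localCenter E c 3 J' J₁ hJ₁ v z) from
              localCenter_comm E c 3 J' J₁ hJ₁ v z g).map ((MpPsi.toRep (localSchrodinger F 3 T' v)).comp s))))),
        η = 1) →
      -- … implies one-section twist rigidity at `(T, J, v)`
      ∀ (s : localPi E c 3 J v →* LocalMp F 3 T v)
        (_hs : ∀ g, MpPsi.proj _ (s g) = iota F E c 3 hcδ hδ hd T hT hJ v g)
        (_hsm : Representation.IsSmooth ((MpPsi.toRep (localSchrodinger F 3 T v)).comp s))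
        (η : localPi E c 3 J v →* ℂˣ) (_hη : IsOpen ((η.ker : Subgroup (localPi E c 3 J v)) : Set (localPi E c 3 J v)))
        (J₁ : Matrix (Fin 1) (Fin 1) E) (hJ₁ : J₁ 0 0 ≠ 0) (χ χ' : localPi E c 1 J₁ v →* ℂˣ)
        (_hχu : ∀ z, ‖((χ z : ℂˣ) : ℂ)‖ = 1) (_hχc : Continuous fun z => ((χ z : ℂˣ) : ℂ))
        (_hχ'u : ∀ z, ‖((χ' z : ℂˣ) : ℂ)‖ = 1) (_hχ'c : Continuous fun z => ((χ' z : ℂˣ) : ℂ))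
        (_hnt : Nontrivial (TwistedCoinv.Coinv
          ((show Representation ℂ (localPi E c 1 J₁ v) (SchwartzBruhat (Fin 3 → v.adicCompletion F)) from
            ((MpPsi.toRep (localSchrodinger F 3 T v)).comp s).comp (localCenter E c 3 J J₁ hJ₁ v))) χ))
        (_hiso : AreIsomorphicRep
          (TwistedCoinv.rep
            (ρW := show Representation ℂ (localPi E c 1 J₁ v) (SchwartzBruhat (Fin 3 → v.adicCompletion F)) from
              ((MpPsi.toRep (localSchrodinger F 3 T v)).comp s).comp (localCenter E c 3 J J₁ hJ₁ v))
            χ ((MpPsi.toRep (localSchrodinger F 3 T v)).comp s)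
            (fun g z => (show Commute g (localCenter E c 3 J J₁ hJ₁ v z) from
              localCenter_comm E c 3 J J₁ hJ₁ v z g).map ((MpPsi.toRep (localSchrodinger F 3 T v)).comp s)))
          (SeesawScalar.twist η (TwistedCoinv.rep
            (ρW := show Representation ℂ (localPi E c 1 J₁ v) (SchwartzBruhat (Fin 3 → v.adicCompletion F)) from
              ((MpPsi.toRep (localSchrodinger F 3 T v)).comp s).comp (localCenter E c 3 J J₁ hJ₁ v))
            χ' ((MpPsi.toRep (localSchrodinger F 3 T v)).comp s)
            (fun g z => (show Commute g (localCenter E c 3 J J₁ hJ₁ v z) from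
              localCenter_comm E c 3 J J₁ hJ₁ v z g).map ((MpPsi.toRep (localSchrodinger F 3 T v)).comp s))))),
        η = 1)
    (hblock : ∀ (F : Type) [Field F] [NumberField F] (E : Type) [Field E] [NumberField E] [Algebra F E]
      [Algebra.IsQuadraticExtension F E] (c : E ≃ₐ[F] E) (δ : E) (hcδ : c δ = -δ) (hδ : δ ≠ 0) (d : F)
      (hd : δ * δ = algebraMap F E d) (v : HeightOneSpectrum (𝓞 F))
      (t : Matrix (Fin 1) (Fin 1) F) (T₂ : Matrix (Fin 2) (Fin 2) F) (ht : t.IsSymm) (hT₂ : T₂.IsSymm)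
      (_htd : IsUnit t.det) (hT₂d : IsUnit T₂.det)
      (J₁ : Matrix (Fin 1) (Fin 1) E) (hJ₁ : J₁ = t.map (algebraMap F E))
      (J₂ : Matrix (Fin 2) (Fin 2) E) (_hJ₂ : J₂ = T₂.map (algebraMap F E))
      (J : Matrix (Fin (1 + 2)) (Fin (1 + 2)) E) (hJ : J = (UnitaryGroup.finSum 1 2 t T₂).map (algebraMap F E))
      (s : localPi E c (1 + 2) J v →* LocalMp F (1 + 2) (UnitaryGroup.finSum 1 2 t T₂) v)
      (hs : ∀ g, MpPsi.proj _ (s g) =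
        iota F E c (1 + 2) hcδ hδ hd (UnitaryGroup.finSum 1 2 t T₂) (UnitaryGroup.isSymm_finSum ht hT₂) hJ v g)
      (J' : Matrix (Fin 1) (Fin 1) E) (hJ' : J' 0 0 ≠ 0)
      (_hE : IsField (UnitaryGroup.LocalRing E v))
      (_hsm : Representation.IsSmooth ((MpPsi.toRep (localSchrodinger F (1 + 2) (UnitaryGroup.finSum 1 2 t T₂) v)).comp s))
      (hJ₂h : (J₂.map c)ᵀ = J₂) (hJ₂det : J₂.det ≠ 0)
      (_hiso₂ : LemD1.IsIsotropic (LemD1OfPlace.standingData E v c 2 J₂ hcδ hδ (le_refl 2) hJ₂h hJ₂det))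
      (_hNP : ∀ (η₁ : localPi E c 1 J₁ v →* ℂˣ),
        IsOpen ((η₁.ker : Subgroup (localPi E c 1 J₁ v)) : Set (localPi E c 1 J₁ v)) →
        (∀ (ξ : localPi E c 1 J₁ v →* ℂˣ), (∀ u, ‖((ξ u : ℂˣ) : ℂ)‖ = 1) → (Continuous fun u => ((ξ u : ℂˣ) : ℂ)) →
          (Nontrivial (TwistedCoinv.Coinv ((MpPsi.toRep (localSchrodinger F 1 t v)).comp
              (restrictLeft F E c v 1 2 hJ₁ hJ hcδ hδ hd ht hT₂ hT₂d s hs)) ξ) ↔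
            Nontrivial (TwistedCoinv.Coinv ((MpPsi.toRep (localSchrodinger F 1 t v)).comp
              (restrictLeft F E c v 1 2 hJ₁ hJ hcδ hδ hd ht hT₂ hT₂d s hs)) (ξ * η₁)))) → η₁ = 1)
      (η : localPi E c (1 + 2) J v →* ℂˣ)
      (_hη : IsOpen ((η.ker : Subgroup (localPi E c (1 + 2) J v)) : Set (localPi E c (1 + 2) J v)))
      (χ χ' : localPi E c 1 J' v →* ℂˣ) (_hχu : ∀ z, ‖((χ z : ℂˣ) : ℂ)‖ = 1)
      (_hχc : Continuous fun z => ((χ z : ℂˣ) : ℂ))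
      (_hχ'u : ∀ z, ‖((χ' z : ℂˣ) : ℂ)‖ = 1) (_hχ'c : Continuous fun z => ((χ' z : ℂˣ) : ℂ))
      (_hiso : AreIsomorphicRep
        (TwistedCoinv.rep
          (ρW := ((MpPsi.toRep (localSchrodinger F (1 + 2) (UnitaryGroup.finSum 1 2 t T₂) v)).comp s).comp
            (localCenter E c (1 + 2) J J' hJ' v))
          χ ((MpPsi.toRep (localSchrodinger F (1 + 2) (UnitaryGroup.finSum 1 2 t T₂) v)).comp s)
          (fun g z => (show Commute g (localCenter E c (1 + 2) J J' hJ' v z) from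
            localCenter_comm E c (1 + 2) J J' hJ' v z g).map
              ((MpPsi.toRep (localSchrodinger F (1 + 2) (UnitaryGroup.finSum 1 2 t T₂) v)).comp s)))
        (SeesawScalar.twist η (TwistedCoinv.rep
          (ρW := ((MpPsi.toRep (localSchrodinger F (1 + 2) (UnitaryGroup.finSum 1 2 t T₂) v)).comp s).comp
            (localCenter E c (1 + 2) J J' hJ' v))
          χ' ((MpPsi.toRep (localSchrodinger F (1 + 2) (UnitaryGroup.finSum 1 2 t T₂) v)).comp s)
          (fun g z => (show Commute g (localCenter E c (1 + 2) J J' hJ' v z) from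
            localCenter_comm E c (1 + 2) J J' hJ' v z g).map
              ((MpPsi.toRep (localSchrodinger F (1 + 2) (UnitaryGroup.finSum 1 2 t T₂) v)).comp s))))),
      η = 1) :
    rankOne_theta_twist_rigidity := by
  refine rankOne_theta_twist_rigidity_of_twistRigid ?_
  intro F _ _ E _ _ _ _ c δ hcδ hδ d hd T hT hTd J hJ v hE s hs hsm η hη J₁ hJ₁ χ χ' hχu hχc hχ'u hχ'c hnt hiso
  /- §1 a rational hyperbolic frame `Pᵀ T P = t ⊕ᶠ T_H`, `(E_v², T_H ⊗ 1)` isotropic -/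
  obtain ⟨P, t, T_H, hJh, hJdet, hP, ht, hT_H, htd, hT_Hd, hiso₂⟩ :=
    RationalHyperbolicFrame.exists_rational_hyperbolic_frame F E c hcδ hδ v hE T hT hTd
  have hT'd : IsUnit (UnitaryGroup.finSum 1 2 t T_H).det :=
    HeisenbergGroup.isUnit_det_of_blocks (finSumFinEquiv : Fin 1 ⊕ Fin 2 ≃ Fin (1 + 2)) t T_H rfl htd hT_Hd
  /- §2 move to the block frame along `P` -/
  refine hframe F E c δ hcδ hδ d hd T (UnitaryGroup.finSum 1 2 t T_H) hT (UnitaryGroup.isSymm_finSum ht hT_H) hTd hT'd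
    J hJ _ rfl P hP v hE ?_ s hs hsm η hη J₁ hJ₁ χ χ' hχu hχc hχ'u hχ'c hnt hiso
  /- §3 one-section twist rigidity at the block frame: `hblock` with the line-block instance of `hNP` -/
  intro s' hs' hsm' η' hη' K hK χ₀ χ₀' hχ₀u hχ₀c hχ₀'u hχ₀'c _ hiso'
  exact hblock F E c δ hcδ hδ d hd v t T_H ht hT_H htd hT_Hd _ rfl _ rfl _ rfl s' hs' K hK hE hsm' hJh hJdet hiso₂
    (fun η₁ hη₁ hper => nonPeriodic_restrictLeft F E c hcδ hδ hd v ht hT_H htd hT_Hd rfl rfl s' hs' hNP hE hsm' η₁ hη₁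
      hper) η' hη' χ₀ χ₀' hχ₀u hχ₀c hχ₀'u hχ₀'c hiso'

end Literature.RepresentationTheory.MoeglinVignerasWaldspurger1987

end
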